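import Summits.Ventures.HodgeRepro2.T5SU11LegendreZeros
import Summits.Ventures.HodgeRepro2.T5SU11LegendreDerivativeSum
import Summits.Ventures.HodgeRepro2.T5SU11LegendreExpansion

/-!
# The Legendre chapter read back on the group: `φ_{2n+2}` never vanishes, its radial derivative is
`2 sinh(2t) P'_n(cosh 2t) ≥ n(n + 1) sinh(2t)`, and every polynomial in `φ_4` is a finite combination of the `φ_{2k+2}`

Three consequences of rows 400, 404 and 409 for the spherical functions of even parameter `φ_{2n+2} = P_n(φ_4)`
(row 363, `T5SU11SphericalLegendreAll.sph_even_eq_sph_four`), where `φ_4(g) = 2|a(g)|² − 1 ≥ 1`: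

* **`φ_{2n+2}(g) ≠ 0` for every `g`** (`sph_even_ne_zero`): all zeros of `P_n` lie in `(−1, 1)` (row 400);
* **`d/dt φ_{2n+2}(a_t) = 2 sinh(2t) P'_n(cosh 2t) ≥ n(n + 1) sinh(2t)` for `t ≥ 0`** (`hasDerivAt_sph_even_hyp`,
  `deriv_sph_even_hyp_ge`): `P'_n ≥ P'_n(1) = n(n + 1)/2` on `[1, ∞)` (row 404) — the even spherical functions grow at
  least like `n(n + 1) sinh(2t)` along the Cartan line, and `φ_{2n+2}(a_t) ≥ 1 + n(n + 1)(cosh(2t) − 1)/2`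
  (`sph_even_hyp_ge`, by integration);
* **every polynomial in `φ_4` is a finite combination of the `φ_{2k+2}`**: `f(φ_4(g)) = Σ_{k ≤ d} c_k(f) φ_{2k+2}(g)` for
  every `f ∈ ℝ[X]` of degree `≤ d` with the Fourier–Legendre coefficients of row 409 (`eval_sph_four_eq_sum`), in
  particular `φ_4(g)^d = Σ_{k ≤ d} c_k(X^d) φ_{2k+2}(g)` (`sph_four_pow_eq_sum`).

Nothing is claimed about (N).

Blind lane: Mathlib + the HodgeRepro2 prefix only; no sorry; axioms ⊆ {propext, Classical.choice,
Quot.sound}.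
-/

namespace Summit.Ventures.HodgeRepro2.T5SU11SphericalLegendreCorollaries

open Polynomial Finset Set
open T5SU11Unimodular T5SU11Cartan T5SU11OneParameter T5SU11SphericalFunction T5SU11SphericalLegendre
  T5SU11SphericalLegendreHigher T5SU11SphericalLegendreAll T5SU11SphericalLegendreLaplace T5SU11LegendreIdentities
  T5SU11JacobiPhaseLawEven T5SU11LegendreZeros T5SU11LegendreDerivativeSum T5SU11LegendreExpansion

/-- **`d/dt φ_{2n+2}(a_t) ≥ n(n + 1) sinh(2t)` for `t ≥ 0`** (`P'_n ≥ n(n + 1)/2` on `[1, ∞)`, row 404). -/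
theorem deriv_sph_even_hyp_ge (n : ℕ) {t : ℝ} (ht : 0 ≤ t) :
    (n : ℝ) * (n + 1) * Real.sinh (2 * t) ≤ 2 * Real.sinh (2 * t) * legQ n (Real.cosh (2 * t)) := by
  have h1 : legQ n 1 ≤ legQ n (Real.cosh (2 * t)) := legQ_one_le_legQ n (Real.one_le_cosh _)
  rw [legQ_one_eq] at h1
  have hs : 0 ≤ Real.sinh (2 * t) := Real.sinh_nonneg_iff.mpr (by linarith)
  nlinarith

section measure

variable [MeasurableSpace Circle] [BorelSpace Circle]

/-- **`φ_{2n+2}(g) ≠ 0` for every `g`**: the zeros of `P_n` lie in `(−1, 1)` and `φ_4(g) ≥ 1`. -/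
theorem sph_even_ne_zero (n : ℕ) (g : SU11) : sph (2 * (n : ℝ) + 2) g ≠ 0 := by
  rw [sph_even_eq_sph_four]
  exact legP_ne_zero_of_one_le_abs n (by rw [abs_of_nonneg (by linarith [one_le_sph_four g])]; exact one_le_sph_four g)

/-- **`d/dt φ_{2n+2}(a_t) = 2 sinh(2t) P'_n(cosh 2t)`.** -/
theorem hasDerivAt_sph_even_hyp (n : ℕ) (t : ℝ) :
    HasDerivAt (fun t => sph (2 * (n : ℝ) + 2) (hyp t)) (2 * Real.sinh (2 * t) * legQ n (Real.cosh (2 * t))) t := by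
  have e : (fun t => sph (2 * (n : ℝ) + 2) (hyp t)) = fun t => legP n (Real.cosh (2 * t)) :=
    funext fun t => sph_even_hyp n t
  rw [e]
  have h := (hasDerivAt_legP n (Real.cosh (2 * t))).comp t (hasDerivAt_cosh_two_mul_self t)
  refine h.congr_deriv ?_
  ring

/-- **`φ_{2n+2}(a_t) ≥ 1 + n(n + 1)(cosh(2t) − 1)/2` for `t ≥ 0`** (integrating the derivative bound). -/
theorem sph_even_hyp_ge (n : ℕ) {t : ℝ} (ht : 0 ≤ t) :
    1 + (n : ℝ) * (n + 1) * (Real.cosh (2 * t) - 1) / 2 ≤ sph (2 * (n : ℝ) + 2) (hyp t) := by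
  -- the difference `D(t) = φ_{2n+2}(a_t) − 1 − n(n+1)(cosh 2t − 1)/2` has `D(0) = 0` and `D' ≥ 0` on `[0, ∞)`
  set D : ℝ → ℝ := fun t => sph (2 * (n : ℝ) + 2) (hyp t) - (1 + (n : ℝ) * (n + 1) * (Real.cosh (2 * t) - 1) / 2)
    with hD
  have hD0 : D 0 = 0 := by
    simp only [hD]
    rw [sph_even_hyp]
    simp [legP_one]
  have hderiv : ∀ s, HasDerivAt D
      (2 * Real.sinh (2 * s) * legQ n (Real.cosh (2 * s)) - (n : ℝ) * (n + 1) * (2 * Real.sinh (2 * s)) / 2) s := by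
    intro s
    have h1 := hasDerivAt_sph_even_hyp n s
    have h2 : HasDerivAt (fun s => 1 + (n : ℝ) * (n + 1) * (Real.cosh (2 * s) - 1) / 2)
        ((n : ℝ) * (n + 1) * (2 * Real.sinh (2 * s)) / 2) s := by
      have := (((hasDerivAt_cosh_two_mul_self s).sub_const 1).const_mul ((n : ℝ) * (n + 1))).div_const 2
        |>.const_add 1
      exact this
    exact h1.sub h2
  have hmono : MonotoneOn D (Set.Ici 0) := by
    refine monotoneOn_of_deriv_nonneg (convex_Ici (0 : ℝ)) (fun s _ => (hderiv s).continuousAt.continuousWithinAt)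
      (fun s _ => (hderiv s).differentiableAt.differentiableWithinAt) fun s hs => ?_
    rw [(hderiv s).deriv]
    have hs0 : (0 : ℝ) ≤ s := (interior_subset hs : s ∈ Set.Ici 0)
    have := deriv_sph_even_hyp_ge n hs0
    linarith
  have := hmono Set.self_mem_Ici ht ht
  rw [hD0] at this
  simp only [hD] at this
  linarith

/-! ### Polynomials in `φ_4` as combinations of the `φ_{2k+2}` -/

/-- **`f(φ_4(g)) = Σ_{k ≤ d} c_k(f) φ_{2k+2}(g)`** for every polynomial `f` of degree `≤ d`. -/
theorem eval_sph_four_eq_sum {d : ℕ} {f : ℝ[X]} (hf : f.natDegree ≤ d) (g : SU11) :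
    f.eval (sph 4 g) = ∑ k ∈ range (d + 1), legendreCoeff f k * sph (2 * (k : ℝ) + 2) g := by
  rw [eval_eq_sum_legendreCoeff hf]
  exact Finset.sum_congr rfl fun k _ => by rw [sph_even_eq_sph_four]

/-- **`φ_4(g)^d = Σ_{k ≤ d} c_k(X^d) φ_{2k+2}(g)`**: the powers of `φ_4` in terms of the even spherical functions. -/
theorem sph_four_pow_eq_sum (d : ℕ) (g : SU11) :
    sph 4 g ^ d = ∑ k ∈ range (d + 1), legendreCoeff (X ^ d) k * sph (2 * (k : ℝ) + 2) g := by
  have h := eval_sph_four_eq_sum (f := (X : ℝ[X]) ^ d) (d := d) (by rw [natDegree_X_pow]) g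
  rwa [eval_pow, eval_X] at h

end measure

end Summit.Ventures.HodgeRepro2.T5SU11SphericalLegendreCorollaries
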